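import Summits.QuantumAdvantage.AdviceFreeQNC0.KernelFibration
import Literature.Probability.LatticeModels.HardCoreCycleSignedSums
import HarnessLib

/-!
# Parity of the number of ACTIVE positions in a fixed set under the kernel-line measure (qn-lit g28, L-34(b) for `HIsoB`)

HOME sketch (literature seat; a prover lands it, cf. P-28c).  For every ring length `n = j+1 ≥ 3` and EVERY set `I` of
positions, the signed count of odd inputs by the parity of `#(I ∩ act x)`, `act x = {g : kline x g = 1}`, satisfies

  `|Σ_{x odd} (−1)^{#(I ∩ act x)}| ≤ 5 · 2^j · (4/5)^{|I| − 1} + 1/2`                      (`parityActive_abs_le`),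

i.e. the parity bias is `≤ 5·(4/5)^{|I|−1} + 2^{−j}` relative to the `2^j` odd inputs — exponentially small in `|I|`, uniformly in the
shape of `I` (intervals, spread sets, twin groups at any distances).  Proof: the law of `J = kline x` is the fugacity-2 hard-core gas
(`Fib19.card_fibre`: the fibre of a hard-core `v` with `Z(v) ≥ 1` zeros has `2^{Z(v)−1}` odd inputs; non-hard-core fibres are empty by
`Fib19.kline_hardCore`; the all-ones fibre has `≤ 1` element by `Fib19.card_filter_inKernel`), so the signed count is `½·cycSum` of the
tree's `Literature.Probability.LatticeModels.HardCoreSigned` (signed transfer potential, `abs_cycSum_two_sign_le`) up to `½`.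
Separation NOT moved; no strategy enters.
-/

namespace Summit.QuantumAdvantage.AdviceFreeQNC0

namespace AffBells28lit

open Finset Literature.Computability.QuantumComplexity Literature.Computability.QuantumComplexity.RingHLF
open Fib19 Literature.Probability.LatticeModels Literature.Probability.LatticeModels.HardCoreSigned

variable {j : ℕ}

/-! ## Hard-core on `Fin (j+1)`: the tree's cyclic `HardCore` is the Literature file's `CycHardCore` -/

/-- Auxiliary step `nxt_eq_succ` (qn-lit g28 sketch `AffBells28ParityActive.lean`, verbatim). -/
theorem nxt_eq_succ {i : Fin (j + 1)} (h : i.val + 1 < j + 1) : nxt i = ⟨i.val + 1, h⟩ :=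
  Fin.ext (Nat.mod_eq_of_lt h)

/-- Auxiliary step `nxt_last` (qn-lit g28 sketch `AffBells28ParityActive.lean`, verbatim). -/
theorem nxt_last : nxt (Fin.last j) = (0 : Fin (j + 1)) :=
  Fin.ext (by simp [nxt])

/-- `Fib19.HardCore v ↔ HardCoreSigned.CycHardCore v` on `Fin (j+1)`, `j ≥ 1`. -/
theorem hardCore_iff_cyc (hj : 1 ≤ j) (v : Fin (j + 1) → Bool) : HardCore v ↔ CycHardCore v := by
  constructor
  · rintro ⟨hnc, -⟩
    refine ⟨fun i hi hbad => hnc i ?_, fun hbad => hnc (Fin.last j) ?_⟩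
    · rw [nxt_eq_succ hi]; exact hbad
    · rw [nxt_last]; exact ⟨hbad.2, hbad.1⟩
  · rintro ⟨hno, hcyc⟩
    refine ⟨fun i hbad => ?_, ?_⟩
    · by_cases hi : i.val + 1 < j + 1
      · exact hno i hi (by rw [← nxt_eq_succ hi]; exact hbad)
      · have hil : i = Fin.last j := Fin.ext (by simp; omega)
        rw [hil, nxt_last] at hbad
        exact hcyc ⟨hbad.2, hbad.1⟩
    · by_contra hall
      push Not at hall
      have h0 : v 0 = false := by simpa using hall 0
      have h1 : v ⟨1, by omega⟩ = false := by simpa using hall ⟨1, by omega⟩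
      exact hno 0 (by simp; omega) ⟨h0, by simpa using h1⟩

/-- `zeros v = 0` iff `v` is all ones. -/
theorem zeros_eq_zero_iff (v : Fin (j + 1) → Bool) : zeros v = 0 ↔ v = fun _ => true := by
  unfold zeros
  rw [Finset.card_eq_zero, Finset.filter_eq_empty_iff]
  constructor
  · intro h; funext i; simpa using h (mem_univ i)
  · rintro rfl i _; simp

/-! ## Fibre cardinalities -/

/-- Number of odd inputs with kernel line `v`. -/
noncomputable def fibreCard (v : Fin (j + 1) → Bool) : ℕ :=
  open scoped Classical in (univ.filter fun x : Fin (j + 1) → Bool => IsOdd x ∧ kline x = v).card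

/-- Auxiliary step `fibreCard_of_hardCore` (qn-lit g28 sketch `AffBells28ParityActive.lean`, verbatim). -/
theorem fibreCard_of_hardCore (hn : 3 ≤ j + 1) {v : Fin (j + 1) → Bool} (hv : HardCore v) (hz : 0 < zeros v) :
    fibreCard v = 2 ^ (zeros v - 1) := by
  classical
  unfold fibreCard
  convert card_fibre hn v hv hz

/-- Auxiliary step `fibreCard_of_not_hardCore` (qn-lit g28 sketch `AffBells28ParityActive.lean`, verbatim). -/
theorem fibreCard_of_not_hardCore (hn : 3 ≤ j + 1) {v : Fin (j + 1) → Bool} (hv : ¬ HardCore v) : fibreCard v = 0 := by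
  classical
  unfold fibreCard
  rw [Finset.card_eq_zero, Finset.filter_eq_empty_iff]
  rintro x - ⟨hodd, hk⟩
  exact hv (hk ▸ kline_hardCore hn x hodd)

/-- Auxiliary step `fibreCard_allOnes_le` (qn-lit g28 sketch `AffBells28ParityActive.lean`, verbatim). -/
theorem fibreCard_allOnes_le (hn : 3 ≤ j + 1) : fibreCard (fun _ : Fin (j + 1) => true) ≤ 1 := by
  classical
  unfold fibreCard
  have hsub : (univ.filter fun x : Fin (j + 1) → Bool => IsOdd x ∧ kline x = fun _ => true)
      ⊆ univ.filter fun x : Fin (j + 1) → Bool => InKernel x (fun _ => true) := by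
    intro x hx
    rw [mem_filter] at hx ⊢
    refine ⟨mem_univ _, ?_⟩
    rw [← hx.2.2]
    exact kline_inKernel hn x hx.2.1
  refine (card_le_card hsub).trans ?_
  rw [card_filter_inKernel (fun _ => true) (fun i h => by simp at h)]
  have : zeros (fun _ : Fin (j + 1) => true) = 0 := (zeros_eq_zero_iff _).2 rfl
  rw [this, pow_zero]

/-! ## The signed count as a fibre sum -/

/-- Parity sign of `#(I ∩ ones v)`. -/
def psign (I : Finset (Fin (j + 1))) (v : Fin (j + 1) → Bool) : ℝ := (-1 : ℝ) ^ (I.filter fun i => v i = true).card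

/-- Auxiliary step `abs_psign` (qn-lit g28 sketch `AffBells28ParityActive.lean`, verbatim). -/
theorem abs_psign (I : Finset (Fin (j + 1))) (v : Fin (j + 1) → Bool) : |psign I v| = 1 := by
  unfold psign; rw [abs_pow, abs_neg, abs_one, one_pow]

/-- Fiberwise: `Σ_{x odd} s(kline x) = Σ_v s(v) · fibreCard v`. -/
theorem sum_odd_eq_sum_fibre (s : (Fin (j + 1) → Bool) → ℝ) :
    open scoped Classical in
    ∑ x ∈ univ.filter (fun x : Fin (j + 1) → Bool => IsOdd x), s (kline x)
      = ∑ v : Fin (j + 1) → Bool, s v * (fibreCard v : ℝ) := by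
  classical
  rw [← Finset.sum_fiberwise_of_maps_to (g := fun x : Fin (j + 1) → Bool => kline x) (t := univ) (fun _ _ => mem_univ _)]
  refine sum_congr rfl fun v _ => ?_
  unfold fibreCard
  rw [Finset.sum_congr rfl (fun x hx => by rw [(mem_filter.mp hx).2] : ∀ x ∈ (univ.filter fun x : Fin (j + 1) → Bool => IsOdd x).filter
      (fun x => kline x = v), s (kline x) = s v), sum_const, nsmul_eq_mul, mul_comm, Finset.filter_filter]

/-- The Literature weight is `2^{zeros} · psign` (with `I` transported to `ℕ` by `Fin.val`). -/
theorem wordWt_eq (I : Finset (Fin (j + 1))) (v : Fin (j + 1) → Bool) :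
    wordWt (fun _ => 2) (signOf (I.image Fin.val)) v = (2 : ℝ) ^ zeros v * psign I v := by
  classical
  rw [wordWt_two_signOf]
  unfold zeros psign
  congr 2
  have : (univ.filter fun i : Fin (j + 1) => v i = true ∧ i.val ∈ I.image Fin.val) = I.filter fun i => v i = true := by
    ext i
    simp only [mem_filter, mem_univ, true_and, mem_image]
    constructor
    · rintro ⟨hv, k, hk, hki⟩
      exact ⟨by rwa [← Fin.ext hki], hv⟩
    · rintro ⟨hi, hv⟩
      exact ⟨hv, i, hi, rfl⟩
  rw [this]

open scoped Classical in
/-- `cycSum` of the Literature file, rewritten over `Fin (j+1) → Bool` with the tree's `HardCore`. -/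
theorem cycSum_eq_sum_hardCore (hj : 1 ≤ j) (I : Finset (Fin (j + 1))) :
    cycSum (fun _ => 2) (signOf (I.image Fin.val)) j
      = ∑ v : Fin (j + 1) → Bool, if HardCore v then (2 : ℝ) ^ zeros v * psign I v else (0 : ℝ) := by
  classical
  unfold cycSum
  refine sum_congr rfl fun v _ => ?_
  rw [wordWt_eq]
  by_cases hv : HardCore v
  · rw [if_pos ((hardCore_iff_cyc hj v).1 hv), if_pos hv]
  · rw [if_neg (fun h => hv ((hardCore_iff_cyc hj v).2 h)), if_neg hv]

open scoped Classical in
/-- Per-fibre comparison: `s(v)·fibreCard v − ½[HardCore v]2^{Z(v)} s(v)` vanishes except at the all-ones word. -/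
theorem fibre_term_eq (hn : 3 ≤ j + 1) (I : Finset (Fin (j + 1))) (v : Fin (j + 1) → Bool) (hv1 : v ≠ fun _ => true) :
    psign I v * (fibreCard v : ℝ) = (1 / 2 : ℝ) * (if HardCore v then (2 : ℝ) ^ zeros v * psign I v else (0 : ℝ)) := by
  by_cases hv : HardCore v
  · have hz : 0 < zeros v := by
      rw [Nat.pos_iff_ne_zero]; exact fun h => hv1 ((zeros_eq_zero_iff v).1 h)
    rw [if_pos hv, fibreCard_of_hardCore hn hv hz]
    obtain ⟨m, hm⟩ : ∃ m, zeros v = m + 1 := ⟨zeros v - 1, by omega⟩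
    rw [hm, Nat.add_sub_cancel, pow_succ]
    push_cast
    ring
  · rw [if_neg hv, fibreCard_of_not_hardCore hn hv]
    simp

/-- **Main identity up to the all-ones fibre**:
`Σ_{x odd} (−1)^{#(I ∩ act x)} = ½ cycSum + (−1)^{|I|}(fibreCard 𝟙 − ½)`. -/
theorem sum_odd_psign_eq (hn : 3 ≤ j + 1) (I : Finset (Fin (j + 1))) :
    open scoped Classical in
    ∑ x ∈ univ.filter (fun x : Fin (j + 1) → Bool => IsOdd x), psign I (kline x)
      = (1 / 2 : ℝ) * cycSum (fun _ => 2) (signOf (I.image Fin.val)) j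
        + psign I (fun _ => true) * ((fibreCard (fun _ : Fin (j + 1) => true) : ℝ) - 1 / 2) := by
  classical
  have hj : 1 ≤ j := by omega
  rw [sum_odd_eq_sum_fibre, cycSum_eq_sum_hardCore hj, mul_sum]
  -- subtract the half-cycSum termwise; only the all-ones word survives
  have key : ∀ v : Fin (j + 1) → Bool,
      psign I v * (fibreCard v : ℝ) - (1 / 2 : ℝ) * (if HardCore v then (2 : ℝ) ^ zeros v * psign I v else (0 : ℝ))
        = if v = (fun _ => true) then psign I (fun _ => true) * ((fibreCard (fun _ : Fin (j + 1) => true) : ℝ) - 1 / 2)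
          else (0 : ℝ) := by
    intro v
    by_cases hv1 : v = fun _ => true
    · subst hv1
      have hH : HardCore (fun _ : Fin (j + 1) => true) := ⟨fun i h => by simp at h, ⟨0, rfl⟩⟩
      have hz : zeros (fun _ : Fin (j + 1) => true) = 0 := (zeros_eq_zero_iff _).2 rfl
      rw [if_pos rfl, if_pos hH, hz, pow_zero, one_mul]
      ring
    · rw [if_neg hv1, fibre_term_eq hn I v hv1, sub_self]
  have hsum := Finset.sum_congr rfl (fun v (_ : v ∈ (univ : Finset (Fin (j + 1) → Bool))) => key v)
  rw [sum_sub_distrib, sum_ite_eq' univ (fun _ : Fin (j + 1) => true), if_pos (mem_univ _)] at hsum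
  linarith

/-- **THE BOUND (L-34(b)).**  For every `I`:  `|Σ_{x odd} (−1)^{#(I ∩ act x)}| ≤ 5 · 2^j · (4/5)^{|I|−1} + 1/2`. -/
theorem parityActive_abs_le (hn : 3 ≤ j + 1) (I : Finset (Fin (j + 1))) :
    open scoped Classical in
    |∑ x ∈ univ.filter (fun x : Fin (j + 1) → Bool => IsOdd x), (-1 : ℝ) ^ (I.filter fun i => kline x i = true).card|
      ≤ 5 * 2 ^ j * (4 / 5 : ℝ) ^ (I.card - 1) + 1 / 2 := by
  classical
  have h := sum_odd_psign_eq hn I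
  unfold psign at h
  rw [h]
  have hcyc := abs_cycSum_two_sign_le (I.image Fin.val) j
  -- the exponent: `#{i ∈ I.image val : 1 ≤ i ≤ j} ≥ |I| − 1`
  have hexp : I.card - 1 ≤ ((I.image Fin.val).filter fun i => 1 ≤ i ∧ i ≤ j).card := by
    have hsub : (I.erase 0).image Fin.val ⊆ (I.image Fin.val).filter fun i => 1 ≤ i ∧ i ≤ j := by
      intro k hk
      rw [mem_image] at hk
      obtain ⟨i, hi, rfl⟩ := hk
      rw [mem_erase] at hi
      rw [mem_filter, mem_image]
      refine ⟨⟨i, hi.2, rfl⟩, ?_, by have := i.isLt; omega⟩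
      rw [Nat.one_le_iff_ne_zero]
      exact fun h0 => hi.1 (Fin.ext h0)
    have hcard : ((I.erase 0).image Fin.val).card = (I.erase 0).card :=
      card_image_of_injective _ Fin.val_injective
    have := card_le_card hsub
    rw [hcard] at this
    have h2 := Finset.pred_card_le_card_erase (s := I) (a := 0)
    omega
  have hpow : (4 / 5 : ℝ) ^ ((I.image Fin.val).filter fun i => 1 ≤ i ∧ i ≤ j).card ≤ (4 / 5 : ℝ) ^ (I.card - 1) :=
    pow_le_pow_of_le_one (by norm_num) (by norm_num) hexp
  have hfib : ((fibreCard (fun _ : Fin (j + 1) => true) : ℝ) - 1 / 2) ≤ 1 / 2 ∧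
      -(1 / 2 : ℝ) ≤ ((fibreCard (fun _ : Fin (j + 1) => true) : ℝ) - 1 / 2) := by
    have h1 := fibreCard_allOnes_le hn (j := j)
    have h1' : ((fibreCard (fun _ : Fin (j + 1) => true) : ℝ)) ≤ 1 := by exact_mod_cast h1
    have h0' : (0 : ℝ) ≤ (fibreCard (fun _ : Fin (j + 1) => true) : ℝ) := by positivity
    constructor <;> linarith
  have habs2 : |(-1 : ℝ) ^ (I.filter fun i => (fun _ : Fin (j + 1) => true) i = true).card
      * (((fibreCard (fun _ : Fin (j + 1) => true) : ℝ)) - 1 / 2)| ≤ 1 / 2 := by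
    rw [abs_mul, abs_pow, abs_neg, abs_one, one_pow, one_mul]
    exact abs_le.mpr ⟨hfib.2, hfib.1⟩
  calc |(1 / 2 : ℝ) * cycSum (fun _ => 2) (signOf (I.image Fin.val)) j
        + (-1 : ℝ) ^ (I.filter fun i => (fun _ : Fin (j + 1) => true) i = true).card
          * (((fibreCard (fun _ : Fin (j + 1) => true) : ℝ)) - 1 / 2)|
      ≤ |(1 / 2 : ℝ) * cycSum (fun _ => 2) (signOf (I.image Fin.val)) j|
        + |(-1 : ℝ) ^ (I.filter fun i => (fun _ : Fin (j + 1) => true) i = true).card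
          * (((fibreCard (fun _ : Fin (j + 1) => true) : ℝ)) - 1 / 2)| := abs_add_le _ _
    _ ≤ (1 / 2 : ℝ) * (10 * 2 ^ j * (4 / 5 : ℝ) ^ ((I.image Fin.val).filter fun i => 1 ≤ i ∧ i ≤ j).card) + 1 / 2 := by
        rw [abs_mul, abs_of_pos (by norm_num : (0 : ℝ) < 1 / 2)]
        exact add_le_add (mul_le_mul_of_nonneg_left hcyc (by norm_num)) habs2
    _ ≤ 5 * 2 ^ j * (4 / 5 : ℝ) ^ (I.card - 1) + 1 / 2 := by
        nlinarith [hpow, pow_nonneg (by norm_num : (0:ℝ) ≤ 2) j]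

end AffBells28lit

end Summit.QuantumAdvantage.AdviceFreeQNC0
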